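import Summits.ABC.IUTFork.Cor312PinnedIndTrivialEngineBeds
import HarnessLib

/-!
# [IUTchIII] Cor. 3.12 — over abc-iut-w4-d098's SCALAR shells the possible images are the `U`-orbit, and with ball glue the residual `S` reads one valuation

Proof-only junction file (D-0012; NO definition, NO `Prop` fact) of the abc-iut cell (WAVE-5 prover abc-iut-w5-d068, gen 5), companion of the laws of the
(Ind)-triviality ledger (`Cor312PinnedIndTrivialBeds5` v2 §4 THE SCALAR LAW `indTrivial_iff_scalars_padicUnits`; v3 §6–§7 GENERATOR / SIGN laws;
`Cor312PinnedIndTrivialUnitLaw`; `Cor312PinnedIndTrivialPermLaw`), over abc-iut-w4-d098's scalar shells `Repair.ScalarShells.scalarShells p U`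
(p429955: carrier `ℚ`, «Ism» = strip-automorphisms = multiplication by an ARBITRARY scalar group `U ≤ ℚˣ`; `U = ℚˣ` is the door-(b) SCALING model of
the beds SCAL / W, `U = ℚ_{>0}` the value chart VAL of abc-iut-rp-j2). TAKES NO SIDE on [IUTchIII] Cor. 3.12 or on any author; toy carriers;
instantiated ≠ endorsed.

RESULTS (ns `Summit.ABC.IUTFork.Cor312Vol.IndTrivial`):
* `apply_eq_smul_of_mem_closure_scalarShells` — every element of ⟨(Ind1) ∪ (Ind2)⟩ acts on a given packet as `x ↦ u • x`, `u ∈ U` (abc-iut-w4-d098's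
  closure lemma `actsByScalars_of_mem_closure` read through the line coordinate); `exists_mem_Ind2Family_apply_eq_smul_scalarShells` — conversely EVERY
  `u ∈ U` is realised at every packet by an (Ind2)-family (`u` on the first tensor factor, `1` on the others);
* **`possibleImages_eq_scalarOrbit`** — for ANY situation `⟨scalarShells p U, D, G⟩` and ANY setting, the possible images at a packet are EXACTLY the
  `U`-orbit `{u·A | u ∈ U}` of `A = thetaRegion3`; **`indTrivial_iff_scalars_stable`** — (Ind)-trivial ⟺ every Θ-region is `U`-stable (the glue-free
  form of the SCALAR LAW; with ball glue `u·B_k = B_{k+v_p(u)}` it specialises to «every scalar of `U` is a `p`-adic unit»);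
* with BALL glue `A = B_k` (`ScalarShells.sBall`): `possibleImages_eq_shiftedBalls` — the possible images are the balls `B_{k+v_p(u)}`, `u ∈ U`; and
  **`residual_iff_scalarShells_balls`** — under Thm. 3.11 (ii)(b) for the column and the two region pins, abc-iut-w5-d230's residual
  `S = PilotKummerIndRelated` READS «at every packet the q-pilot region is a ball whose depth differs from the Θ-ball's by a valuation `v_p(u)`, `u ∈ U`»;
  in particular over the SCALING shells (`U = ℚˣ ∋ p`, `v_p(U) = ℤ`) `S` reads «every q-pilot region is SOME ball» (`residual_iff_scalingShells_balls`) —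
  the kernel form of the branch's door (b): rescaling by the uniformiser supplies `S` for free while Step (x) log-volume invariance fails
  (abc-iut-w4-d098 `sVol_image_sFam_pUnit`).
Consumed BY NAME; standard axioms; typed ≠ proved. [claim: Mochizuki2012, status: disputed] [cite: ScholzeStix2018, §2.2 pp. 9–10]
-/

noncomputable section

open Set

namespace Summit.ABC.IUTFork.Cor312Vol.IndTrivial

open Thm311 Cor312 Cor312.IdentifiedNonVacuity Cor312Vol NaiveWitness NaturalWitness Literature.IUT.LogThetaLattice

section ScalarOrbit

variable (p : ℕ) (U : Subgroup ℚˣ)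

/-- **Every element of ⟨(Ind1) ∪ (Ind2)⟩ of the scalar shells acts on a given packet as `x ↦ u • x` for some `u ∈ U`** (abc-iut-w4-d098's
`actsByScalars_of_mem_closure`: `line (Φ x) = u·line x`; the line coordinate is a linear isomorphism). [folklore] -/
theorem apply_eq_smul_of_mem_closure_scalarShells {Φ : (Repair.ScalarShells.scalarShells p U).PacketAut}
    (hΦ : Φ ∈ Subgroup.closure
      ((Repair.ScalarShells.scalarShells p U).Ind1Family ∪ (Repair.ScalarShells.scalarShells p U).Ind2Family))
    (j : Checks.toyIndex.Label) (vQ : Checks.toyIndex.VQ) :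
    ∃ u : ℚˣ, u ∈ U ∧ ∀ x, Φ j vQ x = (u : ℚ) • x := by
  obtain ⟨u, hu, hΦu⟩ := (Repair.ScalarShells.actsByScalars_of_mem_closure hΦ).scalar j vQ
  exact ⟨u, hu, fun x => (line j vQ).injective ((hΦu x).trans ((map_smul (line j vQ) (u : ℚ) x).trans (smul_eq_mul (u : ℚ) _)).symm)⟩

/-- **Every scalar of `U` is realised at every packet by an (Ind2)-family**: «`u` on the first tensor factor, `1` on the others» (an element of (Ind2)
since `u ∈ U = Ism`) acts on the packet at `(j, v_ℚ)` as `x ↦ u • x`. [folklore] -/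
theorem exists_mem_Ind2Family_apply_eq_smul_scalarShells {u : ℚˣ} (hu : u ∈ U) (j : Checks.toyIndex.Label) (vQ : Checks.toyIndex.VQ) :
    ∃ Φ ∈ (Repair.ScalarShells.scalarShells p U).Ind2Family, ∀ x, Φ j vQ x = (u : ℚ) • x := by
  refine ⟨fun j' vQ' => (Repair.ScalarShells.scalarShells p U).factorwise j' vQ' fun i =>
      (Repair.ScalarShells.scalarShells p U).summandwise vQ' fun _ =>
        if i = 0 then UnitWitness.mulEquiv (u : ℚ) u.ne_zero else LinearEquiv.refl ℚ ℚ,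
    fun j' vQ' => ⟨fun i _ => if i = 0 then UnitWitness.mulEquiv (u : ℚ) u.ne_zero else LinearEquiv.refl ℚ ℚ, fun i _ => ?_, rfl⟩,
    fun x => ?_⟩
  · show (if i = 0 then UnitWitness.mulEquiv (u : ℚ) u.ne_zero else LinearEquiv.refl ℚ ℚ) ∈ Repair.ScalarShells.scalarAuts U
    by_cases h : i = 0
    · rw [if_pos h]; exact Repair.ScalarShells.mulEquiv_mem_scalarAuts U hu
    · rw [if_neg h]; exact Repair.ScalarShells.refl_mem_scalarAuts U
  · apply (line j vQ).injective
    have h := line_factorwise_of_smul j vQ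
      (fun i => (Repair.ScalarShells.scalarShells p U).summandwise vQ fun _ =>
        if i = 0 then UnitWitness.mulEquiv (u : ℚ) u.ne_zero else LinearEquiv.refl ℚ ℚ)
      (fun i => if i = 0 then (u : ℚ) else 1) (fun i y => by
        funext v
        by_cases h : i = 0
        · show (if i = 0 then UnitWitness.mulEquiv (u : ℚ) u.ne_zero else LinearEquiv.refl ℚ ℚ) (y v) =
            ((if i = 0 then (u : ℚ) else (1 : ℚ)) • y) v
          rw [if_pos h, if_pos h]; rfl
        · show (if i = 0 then UnitWitness.mulEquiv (u : ℚ) u.ne_zero else LinearEquiv.refl ℚ ℚ) (y v) =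
            ((if i = 0 then (u : ℚ) else (1 : ℚ)) • y) v
          rw [if_neg h, if_neg h, one_smul]; rfl) x
    rw [Finset.prod_ite_eq', if_pos (Finset.mem_univ _)] at h
    exact h.trans ((map_smul (line j vQ) (u : ℚ) x).trans (smul_eq_mul (u : ℚ) _)).symm

variable (D : ℤ → MRData (Repair.ScalarShells.scalarShells p U))
  (G : ∀ (n : ℤ) (j : Checks.toyIndex.LabelStar), GlobalDegrees (Repair.ScalarShells.scalarShells p U) j)
  (P : Cor312.Setting (⟨Repair.ScalarShells.scalarShells p U, D, G⟩ : Situation Checks.toyIndex))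

/-- **The possible images over the scalar shells are the `U`-ORBIT of the Θ-region** `{u·A | u ∈ U}`, for ANY situation `⟨scalarShells p U, D, G⟩` and ANY
setting. [claim: Mochizuki2012, status: disputed] -/
theorem possibleImages_eq_scalarOrbit (j : Checks.toyIndex.Label) (vQ : Checks.toyIndex.VQ) :
    P.possibleImages j vQ = {V | ∃ u : ℚˣ, u ∈ U ∧ V = (fun x => (u : ℚ) • x) '' P.thetaRegion3 j vQ} := by
  ext V
  constructor
  · rintro ⟨Φ, hΦ, rfl⟩
    obtain ⟨u, hu, hΦu⟩ := apply_eq_smul_of_mem_closure_scalarShells p U hΦ j vQ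
    exact ⟨u, hu, Set.image_congr fun x _ => hΦu x⟩
  · rintro ⟨u, hu, rfl⟩
    obtain ⟨Φ, hΦ, hΦu⟩ := exists_mem_Ind2Family_apply_eq_smul_scalarShells p U hu j vQ
    exact ⟨Φ, Subgroup.subset_closure (Or.inr hΦ), (Set.image_congr fun x _ => hΦu x).symm⟩

/-- **The glue-free SCALAR LAW**: over the scalar shells a setting is (Ind)-trivial iff every Θ-region is `U`-STABLE (`u·A = A` for all `u ∈ U`). With
ball glue (`u·B_k = B_{k+v_p(u)}`) this is `Cor312PinnedIndTrivialBeds5`'s «every scalar of `U` is a `p`-adic unit». [folklore] -/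
theorem indTrivial_iff_scalars_stable :
    (∀ Φ ∈ Setting.indGroup (⟨Repair.ScalarShells.scalarShells p U, D, G⟩ : Situation Checks.toyIndex),
        ∀ (j : Checks.toyIndex.Label) (vQ : Checks.toyIndex.VQ), Φ j vQ '' P.thetaRegion3 j vQ = P.thetaRegion3 j vQ) ↔
      ∀ u : ℚˣ, u ∈ U → ∀ (j : Checks.toyIndex.Label) (vQ : Checks.toyIndex.VQ),
        (fun x => (u : ℚ) • x) '' P.thetaRegion3 j vQ = P.thetaRegion3 j vQ := by
  constructor
  · intro hfix u hu j vQ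
    obtain ⟨Φ, hΦ, hΦu⟩ := exists_mem_Ind2Family_apply_eq_smul_scalarShells p U hu j vQ
    rw [← Set.image_congr fun x (_ : x ∈ P.thetaRegion3 j vQ) => hΦu x]
    exact hfix Φ (Subgroup.subset_closure (Or.inr hΦ)) j vQ
  · intro hstab Φ hΦ j vQ
    obtain ⟨u, hu, hΦu⟩ := apply_eq_smul_of_mem_closure_scalarShells p U hΦ j vQ
    rw [Set.image_congr fun x (_ : x ∈ P.thetaRegion3 j vQ) => hΦu x]
    exact hstab u hu j vQ

variable [hp : Fact p.Prime]

/-- A scalar `u ≠ 0` maps the ball `B_k` onto `B_{k + v_p(u)}` (abc-iut-w4-d098's `image_sBall_of_line_eq` for the homothety `x ↦ u • x`). [folklore] -/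
theorem smul_image_sBall (u : ℚˣ) (j : Checks.toyIndex.Label) (vQ : Checks.toyIndex.VQ) (k : ℤ) :
    (fun x : (Repair.ScalarShells.scalarShells p U).Packet j vQ => (u : ℚ) • x) '' Repair.ScalarShells.sBall p U j vQ k =
      Repair.ScalarShells.sBall p U j vQ (k + padicValRat p (u : ℚ)) := by
  exact Repair.ScalarShells.image_sBall_of_line_eq (U := U)
    (LinearEquiv.smulOfUnit (M := (Repair.ScalarShells.scalarShells p U).Packet j vQ) u)
    u.ne_zero (fun x => (map_smul (line j vQ) (u : ℚ) x).trans (smul_eq_mul (u : ℚ) _)) k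

/-- **Ball glue: the possible images are the SHIFTED BALLS** `B_{k + v_p(u)}`, `u ∈ U`. [claim: Mochizuki2012, status: disputed] -/
theorem possibleImages_eq_shiftedBalls {j : Checks.toyIndex.Label} {vQ : Checks.toyIndex.VQ} {k : ℤ}
    (hk : P.thetaRegion3 j vQ = Repair.ScalarShells.sBall p U j vQ k) :
    P.possibleImages j vQ = {V | ∃ u : ℚˣ, u ∈ U ∧ V = Repair.ScalarShells.sBall p U j vQ (k + padicValRat p (u : ℚ))} := by
  rw [possibleImages_eq_scalarOrbit p U D G P j vQ]
  ext V
  simp only [Set.mem_setOf_eq, hk, smul_image_sBall]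

/-- **THE RESIDUAL OVER THE SCALAR SHELLS WITH BALL GLUE READS ONE VALUATION.** Under Thm. 3.11 (ii) (b) for the column and the two region pins,
abc-iut-w5-d230's `S = PilotKummerIndRelated` holds iff at every packet the q-pilot region is a ball `B_{k + v_p(u)}` for some `u ∈ U`, where `B_k` is the
Θ-region there (`reading3_iff_pilotKummerIndRelated` + `possibleImages_eq_shiftedBalls`). [claim: Mochizuki2012, status: disputed] -/
theorem residual_iff_scalarShells_balls (col : ℤ → Column (Repair.ScalarShells.scalarShells p U))
    (ρ : (∀ v : Checks.toyIndex.V, v ∈ Checks.toyIndex.Vbad → Set ((Repair.ScalarShells.scalarShells p U).StarPacket v)) →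
      ∀ (j : Checks.toyIndex.Label) (vQ : Checks.toyIndex.VQ), Set ((Repair.ScalarShells.scalarShells p U).Packet j vQ))
    (qK : ∀ v : Checks.toyIndex.V, v ∈ Checks.toyIndex.Vbad → Set ((Repair.ScalarShells.scalarShells p U).StarPacket v))
    (k : Checks.toyIndex.Label → Checks.toyIndex.VQ → ℤ)
    (hball : ∀ (j : Checks.toyIndex.Label) (vQ : Checks.toyIndex.VQ), P.thetaRegion3 j vQ = Repair.ScalarShells.sBall p U j vQ (k j vQ))
    (hKumB : (col P.n).KummerB (D P.n))
    (hpin : PinnedRegions (⟨⟨Repair.ScalarShells.scalarShells p U, D, G⟩, col⟩ : LatticeSituation Checks.toyIndex) P ρ qK) :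
    PilotKummerIndRelated (⟨⟨Repair.ScalarShells.scalarShells p U, D, G⟩, col⟩ : LatticeSituation Checks.toyIndex) P ρ qK ↔
      ∀ (j : Checks.toyIndex.Label) (vQ : Checks.toyIndex.VQ),
        ∃ u : ℚˣ, u ∈ U ∧ P.qRegion j vQ = Repair.ScalarShells.sBall p U j vQ (k j vQ + padicValRat p (u : ℚ)) := by
  rw [← reading3_iff_pilotKummerIndRelated
    (⟨⟨Repair.ScalarShells.scalarShells p U, D, G⟩, col⟩ : LatticeSituation Checks.toyIndex) P ρ qK hKumB hpin]
  refine forall₂_congr fun j vQ => ?_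
  rw [possibleImages_eq_shiftedBalls p U D G P (hball j vQ), Set.mem_setOf_eq]

end ScalarOrbit

/-! ## Door (b): over the SCALING shells (`U = ℚˣ`) the residual with ball glue reads «every q-region is SOME ball» -/

section Scaling

variable (p : ℕ) [hp : Fact p.Prime] (D : ℤ → MRData (Repair.ScalarShells.scalingShells p))
  (G : ∀ (n : ℤ) (j : Checks.toyIndex.LabelStar), GlobalDegrees (Repair.ScalarShells.scalingShells p) j)
  (P : Cor312.Setting (⟨Repair.ScalarShells.scalingShells p, D, G⟩ : Situation Checks.toyIndex))

/-- **DOOR (b) AS A LAW.** Over abc-iut-w4-d098's SCALING shells (`U = ℚˣ`: the uniformiser `p` is an indeterminacy, `v_p(U) = ℤ`) a ball-glued setting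
under Thm. 3.11 (ii) (b) and the two region pins satisfies the residual `S` iff EVERY q-PILOT REGION IS SOME BALL — whatever its depth: the rescaling by
`p^a` ∈ ⟨(Ind2)⟩ carries `B_k` onto `B_{k+a}` for every `a ∈ ℤ`. This is why the door-(b) beds (W, SCAL with ball q-regions) satisfy `S` «for free»,
at the price of Step (x) log-volume invariance (abc-iut-w4-d098 `sVol_image_sFam_pUnit`). [claim: Mochizuki2012, status: disputed] -/
theorem residual_iff_scalingShells_balls (col : ℤ → Column (Repair.ScalarShells.scalingShells p))
    (ρ : (∀ v : Checks.toyIndex.V, v ∈ Checks.toyIndex.Vbad → Set ((Repair.ScalarShells.scalingShells p).StarPacket v)) →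
      ∀ (j : Checks.toyIndex.Label) (vQ : Checks.toyIndex.VQ), Set ((Repair.ScalarShells.scalingShells p).Packet j vQ))
    (qK : ∀ v : Checks.toyIndex.V, v ∈ Checks.toyIndex.Vbad → Set ((Repair.ScalarShells.scalingShells p).StarPacket v))
    (k : Checks.toyIndex.Label → Checks.toyIndex.VQ → ℤ)
    (hball : ∀ (j : Checks.toyIndex.Label) (vQ : Checks.toyIndex.VQ), P.thetaRegion3 j vQ = Repair.ScalarShells.sBall p ⊤ j vQ (k j vQ))
    (hKumB : (col P.n).KummerB (D P.n))
    (hpin : PinnedRegions (⟨⟨Repair.ScalarShells.scalingShells p, D, G⟩, col⟩ : LatticeSituation Checks.toyIndex) P ρ qK) :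
    PilotKummerIndRelated (⟨⟨Repair.ScalarShells.scalingShells p, D, G⟩, col⟩ : LatticeSituation Checks.toyIndex) P ρ qK ↔
      ∀ (j : Checks.toyIndex.Label) (vQ : Checks.toyIndex.VQ), ∃ k' : ℤ, P.qRegion j vQ = Repair.ScalarShells.sBall p ⊤ j vQ k' := by
  refine (residual_iff_scalarShells_balls p ⊤ D G P col ρ qK k hball hKumB hpin).trans (forall₂_congr fun j vQ => ⟨?_, ?_⟩)
  · rintro ⟨u, -, hu⟩
    exact ⟨_, hu⟩
  · rintro ⟨k', hk'⟩
    refine ⟨(Repair.ScalarShells.pUnit p) ^ (k' - k j vQ), Subgroup.mem_top _, ?_⟩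
    rw [hk', Units.val_zpow_eq_zpow_val, padicValRat.zpow ((Repair.ScalarShells.pUnit p : ℚˣ) : ℚ), Repair.ScalarShells.padicValRat_pUnit,
      mul_one]
    congr 1
    ring

end Scaling

end Summit.ABC.IUTFork.Cor312Vol.IndTrivial

end
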